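import Summits.HubbardSuperconductivity.HubbardSuperconductivity.Theorems.ThermalWedgeTwSeededEnsembleEquivalenceOfDifferentiablePressure
import Summits.HubbardSuperconductivity.HubbardSuperconductivity.Theorems.ThermalWedgeTwSeededEnsembleEquivalenceAhmTransfer
import Summits.HubbardSuperconductivity.HubbardSuperconductivity.Theorems.ThermalWedgeTwApproximatingHamiltonian

/-!
# Crux `TwSeededEnsembleEquivalence` (stmt-HubbardSuperconductivity-1698) — the crux, as filed and in its
# thermal-window restatement, FROM THE SECANT BRACKET OF THE SOURCED BOGOLIUBOV FUNCTIONAL (finite `L`, no limit)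

Support file (`--supports stmt-HubbardSuperconductivity-1698`; sorry-free; nothing assumed; route-file free). Companion of
`…OfDifferentiablePressure.lean` (the LIMIT form of the physics input). Here the physics input is the FINITE-VOLUME form
registered as the last stub of the thermal member of line `exposed-density-duality` (`stub_thermalSourcedSecantBracket`, "G"):
at an `L`-independent `μ₀` of the window the finite-volume Bogoliubov functional of the SOURCED short-range torus,
`B̃_L(β,μ) = ⨆_h [p̃_L(β,μ,h) − h²/g]`, `p̃_L(β,μ,h) = log Re Z(β, dWaveSourceTorus L U μ h)/(βL²)`, has both one-sided
`μ`-secants within `η` of `1 − δ`, eventually in `L`. No thermodynamic limit is required of it: the approximating-Hamiltonian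
theorem (item 1703, `twApproximatingHamiltonian_proof`) and the landed `stub_ahmTransfer` move the bracket to the seeded pressure,
and `bdl_cruxInstance_of_bracket` (stubs A–E) closes.
* `twSeededEnsembleEquivalence_of_secantBracket`: G for every `U ≤ U₀(δ)`, `g ∈ (0, 1/10]`, `β ≥ 1` ⟹ the VERBATIM body of
  `TwSeededEnsembleEquivalence` as filed (this is the thermal skeleton's `TwSeededEnsembleEquivalence_of` with its one open stub
  as an explicit hypothesis; for `β → ∞` at fixed `g` that hypothesis carries the crux's T = 0 content);
* `tw_thermalWindowEnsemble_of_secantBracket`: G on ONE thermal window `1 ≤ β ≤ e^{a/U}`, `g ∈ [K'U, 1/10]` (∃ a K' U₀ —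
  the in-class form, above the convergent expansion's ceiling) ⟹ the VERBATIM hypothesis `hEns` of
  `twSeededRung_structural_thermalWindow` (the recommended restatement of the crux).
[folklore composition]
-/

set_option linter.dupNamespace false

namespace Summit.HubbardSuperconductivity.HubbardSuperconductivity.Theorems.TwSeededEnsembleEquivalence.ThermalDuality

open Matrix Filter Topology Finset Literature.MathematicalPhysics.QuantumLattice
open scoped ComplexOrder Matrix.Norms.L2Operator

noncomputable section

/-- **`TwSeededEnsembleEquivalence` AS FILED from the finite-volume secant bracket of the sourced Bogoliubov functional**
(the thermal skeleton's composition with its single open stub G as hypothesis; registered on the item by `stub-add`). [folklore] -/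
theorem twSeededEnsembleEquivalence_of_secantBracket :
    (∀ δ ∈ Set.Icc (1/10 : ℝ) (2/5 : ℝ), ∃ μ₁ μ₂ : ℝ, -4 < μ₁ ∧ μ₁ ≤ μ₂ ∧ μ₂ < 0 ∧ ∃ U₀ : ℝ, 0 < U₀ ∧ ∀ U ∈ Set.Ioc (0 : ℝ) U₀, ∀ g ∈ Set.Ioc (0 : ℝ) (1 / 10), ∀ β : ℝ, 1 ≤ β → ∃ μ₀ ∈ Set.Icc μ₁ μ₂, ∀ η : ℝ, 0 < η → ∃ τ : ℝ, 0 < τ ∧ ∃ L₀ : ℕ, ∀ (L : ℕ) [NeZero L], L₀ ≤ L → ((⨆ h : ℝ, ((Real.log (Matrix.partitionFn β (dWaveSourceTorus L U (μ₀ + τ) h)).re / (β * (L : ℝ) ^ 2)) - h ^ 2 / g)) - (⨆ h : ℝ, ((Real.log (Matrix.partitionFn β (dWaveSourceTorus L U μ₀ h)).re / (β * (L : ℝ) ^ 2)) - h ^ 2 / g))) / τ ≤ (1 - δ) + η ∧ (1 - δ) - η ≤ ((⨆ h : ℝ, ((Real.log (Matrix.partitionFn β (dWaveSourceTorus L U μ₀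 h)).re / (β * (L : ℝ) ^ 2)) - h ^ 2 / g)) - (⨆ h : ℝ, ((Real.log (Matrix.partitionFn β (dWaveSourceTorus L U (μ₀ - τ) h)).re / (β * (L : ℝ) ^ 2)) - h ^ 2 / g))) / τ) →
      ∀ δ ∈ Set.Icc (1/10 : ℝ) (2/5 : ℝ), ∃ μ₁ μ₂ : ℝ, -4 < μ₁ ∧ μ₁ ≤ μ₂ ∧ μ₂ < 0 ∧ ∃ U₀ : ℝ, 0 < U₀ ∧
        ∀ U ∈ Set.Ioc (0 : ℝ) U₀, ∀ g ∈ Set.Ioc (0 : ℝ) (1 / 10), ∀ β : ℝ, 1 ≤ β → ∃ μ ∈ Set.Icc μ₁ μ₂, ∀ ε : ℝ, 0 < ε →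
          ∃ L₀ : ℕ, ∀ (L : ℕ) [NeZero L], L₀ ≤ L →
            ((hubbardTorus 2 L 1 U - ((g / (L : ℝ) ^ 2 : ℝ) : ℂ) •
              ((pairField dWaveFormFactor L)ᴴ * pairField dWaveFormFactor L)).minEnergyOn
                (@szSector (FermionTorus 2 L) _ _ (2 * ⌊(1 - δ) * (L : ℝ) ^ 2 / 2⌋₊) 0) / (L : ℝ) ^ 2) +
              (Real.log (Matrix.partitionFn β (hubbardTorusWith 2 L 1 U μ - ((g / (L : ℝ) ^ 2 : ℝ) : ℂ) •
                ((pairField dWaveFormFactor L)ᴴ * pairField dWaveFormFactor L))).re / (β * (L : ℝ) ^ 2)) -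
              μ * ((2 * ⌊(1 - δ) * (L : ℝ) ^ 2 / 2⌋₊) : ℝ) / (L : ℝ) ^ 2 ≤ Real.log 4 / β + ε := by
  intro hG δ hδ
  obtain ⟨μ₁, μ₂, hμ₁, hμ₁₂, hμ₂, U₀, hU₀, hmain⟩ := hG δ hδ
  refine ⟨μ₁, μ₂, hμ₁, hμ₁₂, hμ₂, U₀, hU₀, fun U hU g hg β hβ => ?_⟩
  obtain ⟨μ₀, hμ₀, hbrB⟩ := hmain U hU g hg β hβ
  have hβ0 : 0 < β := lt_of_lt_of_le one_pos hβ
  have hbr := stub_ahmTransfer δ U g β μ₀ hg.1 hβ0 twApproximatingHamiltonian_proof hbrB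
  exact ⟨μ₀, hμ₀, bdl_cruxInstance_of_bracket δ U g β μ₀ hδ hβ hg.1.le hbr⟩

/-- **The THERMAL-WINDOW restatement (`hEns` of `twSeededRung_structural_thermalWindow`) from the secant bracket ON ONE
THERMAL WINDOW** (`∃ a K' U₀`, `g ∈ [K'U, 1/10]`, `1 ≤ β ≤ e^{a/U}`): the in-class, finite-volume shape of the physics input.
[folklore] -/
theorem tw_thermalWindowEnsemble_of_secantBracket
    (hGw : ∀ δ ∈ Set.Icc (1/10 : ℝ) (2/5 : ℝ), ∃ μ₁ μ₂ : ℝ, -4 < μ₁ ∧ μ₁ ≤ μ₂ ∧ μ₂ < 0 ∧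
      ∃ a K' U₀ : ℝ, 0 < a ∧ 0 < K' ∧ 0 < U₀ ∧ ∀ U ∈ Set.Ioc (0 : ℝ) U₀,
        ∀ g ∈ Set.Icc (K' * U) (1 / 10), ∀ β : ℝ, 1 ≤ β → β ≤ Real.exp (a / U) →
          ∃ μ₀ ∈ Set.Icc μ₁ μ₂, ∀ η : ℝ, 0 < η → ∃ τ : ℝ, 0 < τ ∧ ∃ L₀ : ℕ, ∀ (L : ℕ) [NeZero L], L₀ ≤ L →
            ((⨆ h : ℝ, ((Real.log (Matrix.partitionFn β (dWaveSourceTorus L U (μ₀ + τ) h)).re / (β * (L : ℝ) ^ 2)) -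
                h ^ 2 / g)) -
              (⨆ h : ℝ, ((Real.log (Matrix.partitionFn β (dWaveSourceTorus L U μ₀ h)).re / (β * (L : ℝ) ^ 2)) -
                h ^ 2 / g))) / τ ≤ (1 - δ) + η ∧
            (1 - δ) - η ≤
            ((⨆ h : ℝ, ((Real.log (Matrix.partitionFn β (dWaveSourceTorus L U μ₀ h)).re / (β * (L : ℝ) ^ 2)) -
                h ^ 2 / g)) -
              (⨆ h : ℝ, ((Real.log (Matrix.partitionFn β (dWaveSourceTorus L U (μ₀ - τ) h)).re / (β * (L : ℝ) ^ 2)) -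
                h ^ 2 / g))) / τ) :
    ∀ δ ∈ Set.Icc (1/10 : ℝ) (2/5 : ℝ), ∃ μ₁ μ₂ : ℝ, -4 < μ₁ ∧ μ₁ ≤ μ₂ ∧ μ₂ < 0 ∧
      ∃ a K' U₀ : ℝ, 0 < a ∧ 0 < K' ∧ 0 < U₀ ∧ ∀ U ∈ Set.Ioc (0 : ℝ) U₀,
        ∀ g ∈ Set.Icc (K' * U) (1 / 10), ∀ β : ℝ, 1 ≤ β → β ≤ Real.exp (a / U) →
          ∃ μ ∈ Set.Icc μ₁ μ₂, ∀ ε : ℝ, 0 < ε → ∃ L₀ : ℕ, ∀ (L : ℕ) [NeZero L], L₀ ≤ L →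
            ((hubbardTorus 2 L 1 U - ((g / (L : ℝ) ^ 2 : ℝ) : ℂ) •
              ((pairField dWaveFormFactor L)ᴴ * pairField dWaveFormFactor L)).minEnergyOn
                (@szSector (FermionTorus 2 L) _ _ (2 * ⌊(1 - δ) * (L : ℝ) ^ 2 / 2⌋₊) 0) /
                  (L : ℝ) ^ 2) +
              (Real.log (Matrix.partitionFn β (hubbardTorusWith 2 L 1 U μ -
                ((g / (L : ℝ) ^ 2 : ℝ) : ℂ) •
                  ((pairField dWaveFormFactor L)ᴴ * pairField dWaveFormFactor L))).re /
                    (β * (L : ℝ) ^ 2)) -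
              μ * ((2 * ⌊(1 - δ) * (L : ℝ) ^ 2 / 2⌋₊) : ℝ) / (L : ℝ) ^ 2 ≤ Real.log 4 / β + ε := by
  intro δ hδ
  obtain ⟨μ₁, μ₂, hμ₁, hμ₁₂, hμ₂, a, K', U₀, ha, hK', hU₀, hmain⟩ := hGw δ hδ
  refine ⟨μ₁, μ₂, hμ₁, hμ₁₂, hμ₂, a, K', U₀, ha, hK', hU₀, fun U hU g hg β hβ hβa => ?_⟩
  obtain ⟨μ₀, hμ₀, hbrB⟩ := hmain U hU g hg β hβ hβa
  have hβ0 : 0 < β := lt_of_lt_of_le one_pos hβ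
  have hg0 : 0 < g := lt_of_lt_of_le (mul_pos hK' hU.1) hg.1
  have hbr := stub_ahmTransfer δ U g β μ₀ hg0 hβ0 twApproximatingHamiltonian_proof hbrB
  exact ⟨μ₀, hμ₀, bdl_cruxInstance_of_bracket δ U g β μ₀ hδ hβ hg0.le hbr⟩

end

end Summit.HubbardSuperconductivity.HubbardSuperconductivity.Theorems.TwSeededEnsembleEquivalence.ThermalDuality
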